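import Summits.BirchSwinnertonDyer.BirchSwinnertonDyer.Theorems.AlignedTransportAtTwoMainConjectureOfRankZeroBSDAtTwoCyclotomicLayerWeightBudget
import HarnessLib

/-!
# Route `AlignedTransportAtTwo`, crux C2 `MainConjectureOfRankZeroBSDAtTwo` (stmt-BirchSwinnertonDyer-22298):
# THE LAYER-ZERO IDENTIFICATION `rank E(K_0) = rank E(K)` — isomorphic fields have equal Mordell–Weil ranks (any base number field), so every layer
# theorem of the lineage reads at `n = 0` with `rank E(K)` itself: `φ(p) ∣ rank E(K₁) − rank E(K)`, `rank E(K) ≤ rank E(K_m)`, weight zero ⇒ `rank W(ℚ_m) = rank W(ℚ)`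

HONEST FRAMING (cell `bsd-f1-sign2`, WIDTH-5 attached prover seat `bsd-line-att-p5` gen 37 on line `birth` of the lead `bsd-line-att-p2`;
`--supports` stmt-BirchSwinnertonDyer-22298, closes nothing; BSD is NOT proved by any of this; the crux C2, its verdict «blocked-on
`Rank1Residual.GreenbergMuConjectureIrreducible`» and every registered stub are untouched). THEOREMS ONLY — no `def`, no `sorry`. This is the lineage's
successor item (ii) of g36 (memo CYCLOTOMIC-LAYERS §13): the tree's `ZpExtension.layer_zero` says `K_0 = ⊥` as an intermediate field of `K̄/K`; the Mordell–Weil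
rank of `E` over the TYPE `K_0` and over `K` agree by transport of structure along `K_0 ≃ₐ[K] K` (Mathlib `WeierstrassCurve.Affine.Point.map`, functorial). The tree had
this only for `ℚ`-algebra isomorphisms of extensions of `ℚ` (`Literature.Barriers.….mordellWeilRank_baseChange_eq_of_algEquiv`); here for any base field.

* §1 `mordellWeilRank_baseChange_eq_of_algEquiv` (**`F ≃ₐ[K] F' ⇒ rank E(F) = rank E(F')`** for `E/K`, any fields), `mordellWeilRank_baseChange_self`
  (`rank (E.baseChange K) = rank E(K)`), ★ `mordellWeilRank_layer_zero` (**`rank E(K_0) = rank E(K)`** for every `ℤ_p`-extension of a number field).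
* §2 consequences: `mordellWeilRank_le_layer` (`rank E(K) ≤ rank E(K_m)`), `totient_dvd_mordellWeilRank_layer_one_sub` (**`p − 1 ∣ rank E(K₁) − rank E(K)`**, g36's exact
  jump at the bottom layer, any `ℤ_p`-tower of a number field with a torsion dual datum), and over `ℚ` (PRINT `h17`): `mordellWeilRank_layer_eq_of_norm_constantCoeff_lift_eq_one`
  (**`‖L_p(0)‖ = 1 ⇒ rank W(ℚ_m) = rank W(ℚ)` at every layer**), `sub_one_dvd_mordellWeilRank_layer_sub` (**`p − 1 ∣ rank W(ℚ_m) − rank W(ℚ)`** for every `m`).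

References: L. Washington, GTM 83, §13.1 [Washington1997]; R. Greenberg, LNM 1716 (1999), Thm. 1.9 (p. 63) [GreenbergLNM1716]; K. Kato, Astérisque 295 (2004), Thm. 17.4
[Kato2004Asterisque]; J. Silverman, GTM 106, VIII §6 [Silverman2009].
-/

set_option linter.dupNamespace false
set_option autoImplicit false

noncomputable section

open scoped Classical MatrixGroups ModularForm Polynomial

namespace Summit.BirchSwinnertonDyer.BirchSwinnertonDyer.Theorems.AlignedTransportAtTwoCyclotomicLayerZero

open Polynomial CongruenceSubgroup WeierstrassCurve Literature.NumberTheory.EllipticCurves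
  Literature.NumberTheory.EllipticCurves.ModularForms
  Literature.NumberTheory.EllipticCurves.Rank1Residual
  Literature.NumberTheory.EllipticCurves.Greenberg1999
  Summit.BirchSwinnertonDyer.Rank1Residual
  Summit.BirchSwinnertonDyer.Rank1Residual.X1.MuLambda
  Summit.BirchSwinnertonDyer.Rank1Residual.X1.ParitySqueeze
  Summit.BirchSwinnertonDyer.Rank1Residual.Iwasawa
  Summit.BirchSwinnertonDyer.BirchSwinnertonDyer.Theorems.AlignedTransportAtTwoCyclotomicLayerPrime
  Summit.BirchSwinnertonDyer.BirchSwinnertonDyer.Theorems.AlignedTransportAtTwoCyclotomicLayerRankDichotomy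
  Summit.BirchSwinnertonDyer.BirchSwinnertonDyer.Theorems.AlignedTransportAtTwoCyclotomicLayerRankJumpExact
  Summit.BirchSwinnertonDyer.BirchSwinnertonDyer.Theorems.AlignedTransportAtTwoCyclotomicLayerLFunction
  Summit.BirchSwinnertonDyer.BirchSwinnertonDyer.Theorems.AlignedTransportAtTwoCyclotomicLayerWeight
  Summit.BirchSwinnertonDyer.BirchSwinnertonDyer.Theorems.AlignedTransportAtTwoCyclotomicLayerWeightBudget

universe u

/-! ## §1 Isomorphic fields have equal Mordell–Weil ranks; `rank E(K_0) = rank E(K)` -/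

section AnyField

variable {K : Type u} [Field K] (W : WeierstrassCurve K)

/-- **`F ≃ₐ[K] F' ⇒ rank_ℤ E(F) = rank_ℤ E(F')`** for `E/K` over any field: the coordinate transport `E(F) → E(F')` along `e` (Mathlib `Affine.Point.map`, an additive
injection, functorial) has the transport along `e⁻¹` as inverse, so it is a `ℤ`-linear isomorphism. (The tree's `Literature.Barriers` version is `K = ℚ`.)
[cite: Silverman2009, VIII §6] -/
theorem mordellWeilRank_baseChange_eq_of_algEquiv {F F' : Type*} [Field F] [Field F'] [Algebra K F] [Algebra K F'] (e : F ≃ₐ[K] F') :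
    (W.baseChange F).mordellWeilRank = (W.baseChange F').mordellWeilRank := by
  have hsurj : Function.Surjective (Affine.Point.map (W' := W.toAffine) (e : F →ₐ[K] F')) := fun P ↦
    ⟨Affine.Point.map (W' := W.toAffine) (e.symm : F' →ₐ[K] F) P, by
      rw [Affine.Point.map_map, AlgEquiv.comp_symm]
      cases P <;> rfl⟩
  exact (AddEquiv.ofBijective (Affine.Point.map (W' := W.toAffine) (e : F →ₐ[K] F'))
    ⟨Affine.Point.map_injective _, hsurj⟩).toIntLinearEquiv.finrank_eq

/-- `rank (E.baseChange K) = rank E(K)` (`E.baseChange K = E.map id = E`). [folklore] -/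
theorem mordellWeilRank_baseChange_self : (W.baseChange K).mordellWeilRank = W.mordellWeilRank := by
  have h : W.baseChange K = W := by
    rw [WeierstrassCurve.baseChange, Algebra.algebraMap_self, WeierstrassCurve.map_id]
  rw [h]

variable {p : ℕ} [hp : Fact p.Prime]

/-- ★ **`rank E(K_0) = rank E(K)`**: the bottom layer of a `ℤ_p`-extension of a number field `K` is `K_0 = ⊥ ≃ₐ[K] K` (tree `ZpExtension.layer_zero`), and the
Mordell–Weil rank is invariant under `K`-algebra isomorphisms of the field of definition. [cite: Washington1997, §13.1] -/
theorem mordellWeilRank_layer_zero [NumberField K] (κ : ZpExtension K p) : (W.baseChange (κ.layer 0)).mordellWeilRank = W.mordellWeilRank := by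
  have e : (κ.layer 0) ≃ₐ[K] K := (IntermediateField.equivOfEq κ.layer_zero).trans (IntermediateField.botEquiv K (AlgebraicClosure K))
  rw [mordellWeilRank_baseChange_eq_of_algEquiv W e, mordellWeilRank_baseChange_self]

end AnyField

/-! ## §2 Consequences: the lineage's layer theorems read from `K` itself -/

section Consequences

variable {K : Type u} [Field K] [NumberField K] (W : WeierstrassCurve K) [W.IsElliptic] {p : ℕ} [hp : Fact p.Prime]

/-- `rank E(K_0) ≤ rank E(K_m)` (the ranks are monotone up the tower, g36). [cite: Washington1997, §13.1] -/
theorem mordellWeilRank_layer_zero_le_layer (κ : ZpExtension K p) (m : ℕ) :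
    (W.baseChange (κ.layer 0)).mordellWeilRank ≤ (W.baseChange (κ.layer m)).mordellWeilRank := by
  induction m with
  | zero => exact le_rfl
  | succ m ih => exact ih.trans (mordellWeilRank_layer_le_succ W κ m)

/-- **`rank E(K) ≤ rank E(K_m)` at every layer** of any `ℤ_p`-extension of a number field. [cite: Washington1997, §13.1] [cite: GreenbergLNM1716, Thm. 1.9 (p. 63)] -/
theorem mordellWeilRank_le_layer (κ : ZpExtension K p) (m : ℕ) : W.mordellWeilRank ≤ (W.baseChange (κ.layer m)).mordellWeilRank := by
  rw [← mordellWeilRank_layer_zero W κ]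
  exact mordellWeilRank_layer_zero_le_layer W κ m

variable {κ : ZpExtension K p} {γ : Field.absoluteGaloisGroup K}

/-- ★ **`p − 1 ∣ rank E(K₁) − rank E(K)`**: the exact jump of g36 (`…RankJumpExact`) in the bottom layer, read from `K` itself — for every `ℤ_p`-extension of a number
field with a finitely generated torsion dual datum of `Sel_{p^∞}(E/K_∞)` (e.g. the cyclotomic tower of `ℚ` at a good ordinary prime, Kato). At `p = 2` it is void; at
`p = 3`: `rank E(K₁) ≡ rank E(K) (mod 2)`. [cite: GreenbergLNM1716, §5 p. 132] [cite: KuriharaPollack2007, §3.1] -/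
theorem totient_dvd_mordellWeilRank_layer_one_sub (hγ : κ.IsTopGenerator γ) (D : W.SelmerDualData κ γ)
    [Module.Finite (IwasawaAlgebra p) D.X] (hD : D.IsTorsion) :
    p - 1 ∣ (W.baseChange (κ.layer 1)).mordellWeilRank - W.mordellWeilRank := by
  have h := totient_dvd_mordellWeilRank_layer_succ_sub W hγ D hD 0
  rw [pow_zero, one_mul, zero_add, mordellWeilRank_layer_zero] at h
  exact h

/-- ★ **`∃ c, Φ_p(1+T)^c ∣ f ∧ rank E(K₁) = rank E(K) + (p−1)·c`** for every `f ∈ char_Λ X` — the bottom-layer exact jump from `K`. [cite: GreenbergLNM1716, §5 p. 132] -/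
theorem exists_cyclotomicLayer_zero_pow_dvd_and_mordellWeilRank_layer_one_eq (hγ : κ.IsTopGenerator γ) (D : W.SelmerDualData κ γ)
    [Module.Finite (IwasawaAlgebra p) D.X] (hD : D.IsTorsion) {f : IwasawaAlgebra p} (hf : f ∈ D.charIdeal) :
    ∃ c : ℕ, (((cyclotomic (p ^ (0 + 1)) ℤ_[p]).comp (X + 1) : ℤ_[p][X]) : PowerSeries ℤ_[p]) ^ c ∣ f ∧
      (W.baseChange (κ.layer 1)).mordellWeilRank = W.mordellWeilRank + (p - 1) * c := by
  obtain ⟨c, hdvd, hc⟩ := exists_cyclotomicLayer_pow_dvd_and_mordellWeilRank_eq W hγ D hD hf 0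
  refine ⟨c, hdvd, ?_⟩
  rw [pow_zero, one_mul, zero_add, mordellWeilRank_layer_zero] at hc
  exact hc

end Consequences

/-! ## §3 Over `ℚ` (PRINT `h17`): the weight budget and the weight-zero corner from `ℚ` up -/

section OverQ

open Literature.NumberTheory.EllipticCurves.Rank1Residual

variable (W : WeierstrassCurve ℚ) [W.IsElliptic] [W.IsGloballyMinimal] {p : ℕ} [hp : Fact p.Prime]

/-- **`‖L_p(0)‖ = 1 ⇒ rank W(ℚ_m) = rank W(ℚ)` AT EVERY LAYER `m`** of the cyclotomic `ℤ_p`-tower (`W/ℚ` good ordinary at `p`, PRINT `h17`, `G` an integral lift of `L_p(f,α)` with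
unit constant term, i.e. `p ∤ #Ẽ(𝔽_p)` and `[0]⁺_f` a `p`-unit): no layer prime divides a unit. [cite: Kato2004Asterisque, Thm. 17.4 (1)(2) (p. 273)] [cite: GreenbergLNM1716, §4 Thm. 4.1 (p. 86)] -/
theorem mordellWeilRank_layer_eq_of_norm_constantCoeff_lift_eq_one {N : ℕ} [NeZero N] {f : CuspForm (Gamma0 N) 2}
    (h17 : kato_divisibility_allPrimes W p (f := f)) (hord : IsOrdinaryAt W p) (hf : IsNewformOf W f)
    {G : IwasawaAlgebra p} (hG : iwasawaToPowerSeries p G = padicLFunction f (unitRoot W p : ℚ_[p]))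
    (hw : ‖PowerSeries.constantCoeff G‖ = 1)
    {κ : ZpExtension ℚ p} {γ : Field.absoluteGaloisGroup ℚ} (hκ : κ.IsCyclotomic) (hγ : κ.IsTopGenerator γ)
    (hγ' : IsCyclotomicVariable p γ) (m : ℕ) :
    (W.baseChange (κ.layer m)).mordellWeilRank = W.mordellWeilRank := by
  -- restate the layer-zero identification in this section's elaboration of `rank W(ℚ_0)`
  have h0 : (W.baseChange (κ.layer 0)).mordellWeilRank = W.mordellWeilRank := mordellWeilRank_layer_zero W κ
  rw [mordellWeilRank_layer_eq_layer_zero_of_norm_constantCoeff_lift_eq_one W h17 hord hf hG hw hκ hγ hγ' m, h0]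

/-- **`rank W(ℚ_m) − rank W(ℚ)` is a sum of EXACT jumps `pⁿ(p−1)·c_n` over the layers `n < m`, hence `p − 1 ∣ rank W(ℚ_m) − rank W(ℚ)`** for every `m` (cyclotomic tower of
`ℚ`, PRINT `h17` at a good ordinary `p` supplies the torsion dual datum). [cite: Kato2004Asterisque, Thm. 17.4 (1) (p. 273)] [cite: GreenbergLNM1716, §5 p. 132] -/
theorem sub_one_dvd_mordellWeilRank_layer_sub {N : ℕ} [NeZero N] {f : CuspForm (Gamma0 N) 2}
    (h17 : kato_divisibility_allPrimes W p (f := f)) (hord : IsOrdinaryAt W p) (hf : IsNewformOf W f)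
    {κ : ZpExtension ℚ p} {γ : Field.absoluteGaloisGroup ℚ} (hκ : κ.IsCyclotomic) (hγ : κ.IsTopGenerator γ)
    (hγ' : IsCyclotomicVariable p γ) (m : ℕ) :
    p - 1 ∣ (W.baseChange (κ.layer m)).mordellWeilRank - W.mordellWeilRank := by
  obtain ⟨D⟩ := W.nonempty_selmerDualData_holds κ γ hγ
  haveI : Module.Finite (IwasawaAlgebra p) D.X := D.module_finite_holds hγ
  have hD : D.IsTorsion := (h17 κ γ hκ hγ hγ' hord hf D).1
  have h0 : (W.baseChange (κ.layer 0)).mordellWeilRank = W.mordellWeilRank := mordellWeilRank_layer_zero W κ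
  induction m with
  | zero => rw [h0, Nat.sub_self]; exact dvd_zero _
  | succ m ih =>
    have h1 := totient_dvd_mordellWeilRank_layer_succ_sub W hγ D hD m
    have hle0 : W.mordellWeilRank ≤ (W.baseChange (κ.layer m)).mordellWeilRank := mordellWeilRank_le_layer W κ m
    have hle1 : (W.baseChange (κ.layer m)).mordellWeilRank ≤ (W.baseChange (κ.layer (m + 1))).mordellWeilRank :=
      mordellWeilRank_layer_le_succ W κ m
    have h2 : p - 1 ∣ (W.baseChange (κ.layer (m + 1))).mordellWeilRank - (W.baseChange (κ.layer m)).mordellWeilRank :=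
      (Dvd.intro_left _ rfl).trans h1
    have h3 : (W.baseChange (κ.layer (m + 1))).mordellWeilRank - W.mordellWeilRank =
        ((W.baseChange (κ.layer m)).mordellWeilRank - W.mordellWeilRank) +
          ((W.baseChange (κ.layer (m + 1))).mordellWeilRank - (W.baseChange (κ.layer m)).mordellWeilRank) := by omega
    rw [h3]
    exact dvd_add ih h2

end OverQ

end Summit.BirchSwinnertonDyer.BirchSwinnertonDyer.Theorems.AlignedTransportAtTwoCyclotomicLayerZero
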